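import Literature.AlgebraicGeometry.ShimuraVarieties.UnitaryAuxiliaryTorusDatum
import Literature.NumberTheory.NumberFields.FiniteIdeleHomIdealDescent
import Literature.NumberTheory.AdelicBaseChange.IdeleConormIdeals
import Literature.NumberTheory.AdelicBaseChange.AutomorphicCompat
import HarnessLib

/-!
# The unit level `T₀(𝔸_f) ∩ ∏_v 𝒪_{L,v}^×` of the auxiliary torus: a canonical open compact subgroup of `T₀(𝔸_f)`

Topic `AlgebraicGeometry/ShimuraVarieties`; namespace
`Literature.AlgebraicGeometry.ShimuraVarieties.UnitaryCanonicalModel.Aux` (the auxiliary torus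
`T₀ = {z ∈ Res_{L/ℚ} 𝔾_m | z · c(z) ∈ 𝔾_{m,ℚ}}` of `UnitaryAuxiliaryTorusDatum`: `Aux.torusRat`, `Aux.torusFinAdelic`,
`Aux.toTorusFinAdelic`, `Aux.classGroup`).  ONE definition with a body (`Aux.unitLevel`, an element of the TREE's type
`C5.OpenCompactSubgroup ↥(Aux.torusFinAdelic L)` — no new structure, no instance, no named fact) and theorems.  Cell
hodgecm-mathlib, fan B, rung B-I, step (1) «g6» of the route card `B1TorusClassFinite` (the level at which the named fact
g5 `Aux.finite_classGroup_printed` is first discharged, and SOME level `L₀` to instantiate Deligne's canonical model of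
the auxiliary Hodge-type datum, F1 `Aux.canonicalModel_exists_printed`).  HC_CM is proved only modulo the 7 printed
citations until rung 0 closes; nothing here changes that.

## Mathematics

Let `G = 𝔸_{L,f}^×` be the finite idèles of the CM field `L`, `𝒰_L = ∏_v 𝒪_{L,v}^× ≤ G` the unit idèles — in the tree
the KERNEL of «idèle ↦ ideal», `(IdeleIdeal.toIdealUnits (𝓞 L) L).ker` ([CasselsFrohlichANT1967] Ch. II §17, §19: «the
kernel of the map `J_k → I_k` … is just the group `U_k` of ideles `α` which have `|α_v|_v = 1` for every
non-archimedean `v`»), which is OPEN (a basic open set `∏_v 𝒪_v^×` of the restricted product, §16) and COMPACT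
(`IdeleIdeal.isCompact_ker_toIdealUnits`), indeed the unique maximal compact subgroup of `G`
(`IdeleIdeal.le_ker_toIdealUnits_of_isCompact`) — and `T = T₀(𝔸_f) = {z ∈ G | z · (c ⊗ 1) z ∈ 𝔸_{ℚ,f}^×}`
(`Aux.torusFinAdelic L`).

* §1 `isOpen_ker_toIdealUnits`: `𝒰_L` is open in `G` (the finite-idèle analogue of the tree's
  `GaloisRepresentations.isOpen_unitIdeles`).
* §2 `mem_ker_toIdealUnits_of_finiteIdeleConorm_mem` / `finiteIdeleConorm_mem_ker_toIdealUnits_iff`: for number fields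
  `K ⊆ L` a finite idèle `x` of `K` is a unit idèle iff its conorm `con_{L/K} x` ([CasselsFrohlichANT1967] II (19.2)) is:
  `ord_w(con x) = e_w · ord_{w ∩ K}(x)` (`AdelicBaseChange.unitOrd_finiteIdeleConorm`, (19.20)–(19.21)) with `e_w ≥ 1`
  and every `v` below some `w`.
* §3 `units_map_conjFiniteAdele_mem_ker_toIdealUnits`: `c ⊗ 1` preserves `𝒰_L` (a continuous automorphism of `G` maps the
  maximal compact subgroup into itself: `IdeleIdeal.map_ker_le_ker`); hence (`exists_mem_ker_of_mem_torusFinAdelic`) for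
  `z ∈ T ∩ 𝒰_L` the similitude factor `q`, `z · (c ⊗ 1) z = q ⊗ 1`, is a UNIT idèle of `ℚ` (`q ∈ Ẑ^× = 𝒰_ℚ`), and
  `T ∩ 𝒰_L = 𝒰_L ∩ {z | z · (c ⊗ 1) z ∈ (𝒰_ℚ) ⊗ 1}` (`coe_torusFinAdelic_inter_ker_eq`) is compact: `(𝒰_ℚ) ⊗ 1` is a
  compact, hence closed, subset of `𝔸_{L,f}` and `z ↦ z · (c ⊗ 1) z` is continuous (`isCompact_coe_torusFinAdelic_inter_ker`).
* §4 **`Aux.unitLevel L : C5.OpenCompactSubgroup ↥(Aux.torusFinAdelic L)`** — the subgroup `U = T ∩ 𝒰_L` of `T`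
  (`(toIdealUnits (𝓞 L) L).ker.subgroupOf (torusFinAdelic L)`), open (§1, subspace topology) and compact (§3, `T → G` is an
  embedding); `mem_unitLevel_iff`; **`le_unitLevel_of_isCompact`**: EVERY subgroup of `T` with compact underlying set —
  in particular every level `L₀ : C5.OpenCompactSubgroup ↥T` (`openCompactSubgroup_le_unitLevel`) — is contained in
  `U` (maximal compactness of `𝒰_L`), so `U` is the LARGEST open compact level of `T₀(𝔸_f)`
  (`classGroup_map_surjective_of_le`: the class group `Aux.classGroup L L₀ = T₀(ℚ)\T₀(𝔸_f)/L₀` at a finer level maps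
  onto the one at a coarser level).  `finiteIndex_subgroupOf_unitLevel`: an open compact level has finite index in
  `U` (open subgroup of a compact group), whence the LEVEL CHANGE `finite_classGroup_of_finite_classGroup_unitLevel`:
  `Finite (Aux.classGroup L (unitLevel L)) → ∀ L₀, Finite (Aux.classGroup L L₀)` — step (5) of the route card in full,
  so the named fact g5 `Aux.finite_classGroup_printed` reduces to the single level `U`.

[cite: CasselsFrohlichANT1967, Ch. II §16–§17, §19] for the unit idèles and the conorm; [Milne2005ShimuraVarieties]
p. 62 L34–40 («`T(ℚ)\T(𝔸_f)/K` (finite discrete set)», the zero-dimensional Shimura varieties, any open compact `K`)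
for the role of the level; [Liu2021] App. C Def. C.11 (p. 110) for `T₀`.

NOT here: the finiteness of `Aux.classGroup L (unitLevel L)` itself (steps (2)–(4) of the route card: `h_ℚ = 1`, the
class group of `𝓞_L`, Dirichlet; another seat).

## References
* [CasselsFrohlichANT1967] J. W. S. Cassels, A. Fröhlich (eds.), *Algebraic Number Theory* (1967), Ch. II (Cassels,
  *Global fields*) §16 (restricted topological product), §17 (`J_k → I_k`, kernel `U_k`), §19 ((19.2), (19.20)–(19.21)).
* [Milne2005ShimuraVarieties] J. S. Milne, *Introduction to Shimura varieties* (2005), p. 62 L34–40.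
* [Liu2021] Y. Liu, *Fourier–Jacobi cycles and arithmetic relative trace formula*, Camb. J. Math. 9 (2021), App. C
  Def. C.11 (p. 110).
* [Bump1997] D. Bump, *Automorphic Forms and Representations* (1997), §3.3 (`∏_{v ∉ S_∞} GL(n, 𝔬_v)` open compact,
  maximal compact; `n = 1`).
-/

set_option autoImplicit false

noncomputable section

open Function NumberField IsDedekindDomain Topology
open scoped RestrictedProduct
open Literature.NumberTheory.NumberFields
open Literature.NumberTheory.NumberFields.IdeleIdeal (toIdealUnits mem_ker_toIdealUnits_iff le_ker_toIdealUnits_of_isCompact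
  isCompact_ker_toIdealUnits map_ker_le_ker forall_apply_mem_of_mem_ker mem_ker_of_forall_apply_mem)
open Literature.NumberTheory.AdelicBaseChange (finiteIdeleConorm coe_finiteIdeleConorm unitOrd_finiteIdeleConorm
  finiteAdeleRing_mapSemialgHom_apply_eq_baseChange)
open Literature.NumberTheory.Automorphic Literature.NumberTheory.Automorphic.UnitaryGroup
open Literature.NumberTheory.Automorphic.FiniteAdeleRing (unitOrd)
open Literature.NumberTheory.Automorphic.Liu2021.AppendixC (C5.OpenCompactSubgroup)

namespace Literature.AlgebraicGeometry.ShimuraVarieties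

namespace UnitaryCanonicalModel

namespace Aux

/-! ### §1. The unit idèles `∏_v 𝒪_vˣ = ker (J_{L,f} → I_L)` are open -/

section UnitIdeles

variable (K : Type) [Field K] [NumberField K]

/-- **The unit idèles `U_K = ∏_v 𝒪_vˣ` are OPEN in the finite idèles** `J_{K,f}`: `U_K` is the set of idèles `u` with
`u_v ∈ 𝒪_v` and `(u⁻¹)_v ∈ 𝒪_v` for all `v` (`IdeleIdeal.forall_apply_mem_of_mem_ker` / `mem_ker_of_forall_apply_mem`),
and `{a | ∀ v, a_v ∈ 𝒪_v} = ∏_v 𝒪_v` is a basic open set of the restricted product `𝔸_{K,f}` (Mathlib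
`RestrictedProduct.isOpen_forall_mem`, each `𝒪_v` open), pulled back along the two continuous maps `u ↦ u`, `u ↦ u⁻¹`
of the unit topology.  Finite-idèle analogue of the tree's `GaloisRepresentations.isOpen_unitIdeles`.
[cite: CasselsFrohlichANT1967, Ch. II §16–§17 (restricted topological product; the kernel U_k of J_k → I_k)] -/
theorem isOpen_ker_toIdealUnits : IsOpen ((toIdealUnits (𝓞 K) K).ker : Set (FiniteAdeleRing (𝓞 K) K)ˣ) := by
  have hO : IsOpen {f : FiniteAdeleRing (𝓞 K) K | ∀ v : HeightOneSpectrum (𝓞 K), f v ∈ v.adicCompletionIntegers K} :=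
    RestrictedProduct.isOpen_forall_mem fun v => Valued.isOpen_valuationSubring _
  have h1 : Continuous fun x : (FiniteAdeleRing (𝓞 K) K)ˣ => (x : FiniteAdeleRing (𝓞 K) K) := Units.continuous_val
  have h2 : Continuous fun x : (FiniteAdeleRing (𝓞 K) K)ˣ => ((x⁻¹ : (FiniteAdeleRing (𝓞 K) K)ˣ) : FiniteAdeleRing (𝓞 K) K) :=
    Units.continuous_coe_inv
  have heq : ((toIdealUnits (𝓞 K) K).ker : Set (FiniteAdeleRing (𝓞 K) K)ˣ) =
      (fun x : (FiniteAdeleRing (𝓞 K) K)ˣ => (x : FiniteAdeleRing (𝓞 K) K)) ⁻¹'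
          {f | ∀ v : HeightOneSpectrum (𝓞 K), f v ∈ v.adicCompletionIntegers K} ∩
        (fun x : (FiniteAdeleRing (𝓞 K) K)ˣ => ((x⁻¹ : (FiniteAdeleRing (𝓞 K) K)ˣ) : FiniteAdeleRing (𝓞 K) K)) ⁻¹'
          {f | ∀ v : HeightOneSpectrum (𝓞 K), f v ∈ v.adicCompletionIntegers K} := by
    ext u
    simp only [SetLike.mem_coe, Set.mem_inter_iff, Set.mem_preimage, Set.mem_setOf_eq]
    exact ⟨fun hu => ⟨fun v => (forall_apply_mem_of_mem_ker hu v).1, fun v => (forall_apply_mem_of_mem_ker hu v).2⟩,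
      fun h => mem_ker_of_forall_apply_mem h.1 h.2⟩
  rw [heq]
  exact (hO.preimage h1).inter (hO.preimage h2)

end UnitIdeles

/-! ### §2. A finite idèle is a unit idèle iff its conorm is -/

section Conorm

variable (K L : Type) [Field K] [NumberField K] [Field L] [NumberField L] [Algebra K L]

/-- **`con_{L/K} x ∈ U_L ⟹ x ∈ U_K`**: if the conorm of a finite idèle `x` of `K` is a unit idèle of `L`, then `x` is
a unit idèle of `K` — at a place `v` of `K` choose `w ∣ v` (`HeightOneSpectrum.under_surjective`); then
`0 = ord_w(con x) = e_w · ord_v(x)` ([CasselsFrohlichANT1967] II (19.20)–(19.21), the tree's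
`AdelicBaseChange.unitOrd_finiteIdeleConorm`) with `e_w ≠ 0` (Mathlib `Ideal.ramificationIdx_pos`).
[cite: CasselsFrohlichANT1967, Ch. II §19 ((19.2), (19.20)–(19.21); «con_{K/k} U_k ⊂ U_K»)] -/
theorem mem_ker_toIdealUnits_of_finiteIdeleConorm_mem {x : (FiniteAdeleRing (𝓞 K) K)ˣ}
    (hx : finiteIdeleConorm K L x ∈ (toIdealUnits (𝓞 L) L).ker) : x ∈ (toIdealUnits (𝓞 K) K).ker := by
  rw [mem_ker_toIdealUnits_iff] at hx ⊢
  intro v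
  obtain ⟨w, hw⟩ := HeightOneSpectrum.under_surjective (A := 𝓞 K) (B := 𝓞 L) v
  have h := hx w
  rw [unitOrd_finiteIdeleConorm] at h
  have hwv : w.under (𝓞 K) = v := hw
  rw [hwv] at h
  haveI := w.isPrime
  have he : (w.asIdeal.ramificationIdx (𝓞 K) : ℤ) ≠ 0 := by
    exact_mod_cast (Ideal.ramificationIdx_pos (w.asIdeal) (𝓞 K)).ne'
  exact (mul_eq_zero.mp h).resolve_left he

/-- **`x ∈ U_K ⟺ con_{L/K} x ∈ U_L`** for a finite idèle `x` of `K` («`con_{K/k} U_k ⊂ U_K`», the tree's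
`AdelicBaseChange.finiteIdeleConorm_mem_ker`, and `mem_ker_toIdealUnits_of_finiteIdeleConorm_mem`).
[cite: CasselsFrohlichANT1967, Ch. II §19 («con_{K/k} U_k ⊂ U_K»; (19.20)–(19.21))] -/
theorem finiteIdeleConorm_mem_ker_toIdealUnits_iff (x : (FiniteAdeleRing (𝓞 K) K)ˣ) :
    finiteIdeleConorm K L x ∈ (toIdealUnits (𝓞 L) L).ker ↔ x ∈ (toIdealUnits (𝓞 K) K).ker :=
  ⟨mem_ker_toIdealUnits_of_finiteIdeleConorm_mem K L,
    Literature.NumberTheory.AdelicBaseChange.finiteIdeleConorm_mem_ker K L⟩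

/-- The conorm of a finite idèle IS its base change: `(con_{L/K} x : 𝔸_{L,f}) = (x)_L` for the tree's
`FiniteAdeleRing.baseChange (𝓞 K) K L (𝓞 L)` (the packet's `mapSemialgHom` and the tree's `baseChange` coincide,
`AdelicBaseChange.finiteAdeleRing_mapSemialgHom_apply_eq_baseChange`). [cite: CasselsFrohlichANT1967, Ch. II §14 and §19 (19.2)] -/
theorem coe_finiteIdeleConorm_eq_baseChange (x : (FiniteAdeleRing (𝓞 K) K)ˣ) :
    ((finiteIdeleConorm K L x : (FiniteAdeleRing (𝓞 L) L)ˣ) : FiniteAdeleRing (𝓞 L) L) =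
      FiniteAdeleRing.baseChange (𝓞 K) K L (𝓞 L) (x : FiniteAdeleRing (𝓞 K) K) := by
  rw [coe_finiteIdeleConorm, finiteAdeleRing_mapSemialgHom_apply_eq_baseChange]

end Conorm

/-! ### §3. `c ⊗ 1` preserves the unit idèles; `T₀(𝔸_f) ∩ U_L` and the unit idèles of `ℚ` -/

section Torus

variable (L : Type) [Field L] [NumberField L] [IsCMField L]

/-- **`c ⊗ 1` maps unit idèles to unit idèles**: for `u ∈ U_L = ∏_v 𝒪_{L,v}^×`, `(c ⊗ 1) u ∈ U_L` — `c ⊗ 1`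
(`UnitaryGroup.conjFiniteAdele`) is a continuous ring endomorphism of `𝔸_{L,f}`, so it induces a continuous
endomorphism of the finite idèles, which maps the compact `U_L` to a compact subgroup, contained in the maximal compact
subgroup `U_L` (`IdeleIdeal.map_ker_le_ker`). [cite: CasselsFrohlichANT1967, Ch. II §19 («con_{K/k} U_k ⊂ U_K», here for the automorphism c)]
[cite: Bump1997, §3.3 (maximal compact subgroup, n = 1)] -/
theorem units_map_conjFiniteAdele_mem_ker_toIdealUnits {u : (FiniteAdeleRing (𝓞 L) L)ˣ}
    (hu : u ∈ (toIdealUnits (𝓞 L) L).ker) :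
    Units.map (conjFiniteAdele (↥(maximalRealSubfield L)) L (IsCMField.complexConj L) :
        FiniteAdeleRing (𝓞 L) L →* FiniteAdeleRing (𝓞 L) L) u ∈ (toIdealUnits (𝓞 L) L).ker :=
  map_ker_le_ker
    (Units.map (conjFiniteAdele (↥(maximalRealSubfield L)) L (IsCMField.complexConj L) :
      FiniteAdeleRing (𝓞 L) L →* FiniteAdeleRing (𝓞 L) L))
    (Continuous.units_map _ (continuous_conjFiniteAdele (↥(maximalRealSubfield L)) L (IsCMField.complexConj L)))
    (Subgroup.mem_map_of_mem _ hu)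

/-- **The similitude factor of a unit idèle of `T₀` is a unit idèle of `ℚ`**: if `z ∈ T₀(𝔸_f)` (`z · (c ⊗ 1) z = q ⊗ 1`
for a finite idèle `q` of `ℚ`) and `z ∈ U_L`, then `q ∈ U_ℚ = Ẑ^×`: `z · (c ⊗ 1) z ∈ U_L`
(`units_map_conjFiniteAdele_mem_ker_toIdealUnits`), i.e. `con_{L/ℚ} q ∈ U_L`, and §2. [cite: CasselsFrohlichANT1967, Ch. II §19 ((19.20)–(19.21))]
[cite: Liu2021, App. C Def. C.11 (p. 110)] -/
theorem exists_mem_ker_of_mem_torusFinAdelic {z : (FiniteAdeleRing (𝓞 L) L)ˣ} (hz : z ∈ torusFinAdelic L)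
    (hzU : z ∈ (toIdealUnits (𝓞 L) L).ker) :
    ∃ q : (FiniteAdeleRing (𝓞 ℚ) ℚ)ˣ, q ∈ (toIdealUnits (𝓞 ℚ) ℚ).ker ∧
      (z : FiniteAdeleRing (𝓞 L) L) * conjFiniteAdele (↥(maximalRealSubfield L)) L (IsCMField.complexConj L) z =
        FiniteAdeleRing.baseChange (𝓞 ℚ) ℚ L (𝓞 L) (q : FiniteAdeleRing (𝓞 ℚ) ℚ) := by
  obtain ⟨q, hq⟩ := hz
  refine ⟨q, ?_, hq⟩
  apply mem_ker_toIdealUnits_of_finiteIdeleConorm_mem ℚ L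
  have hprod : z * Units.map (conjFiniteAdele (↥(maximalRealSubfield L)) L (IsCMField.complexConj L) :
      FiniteAdeleRing (𝓞 L) L →* FiniteAdeleRing (𝓞 L) L) z ∈ (toIdealUnits (𝓞 L) L).ker :=
    mul_mem hzU (units_map_conjFiniteAdele_mem_ker_toIdealUnits L hzU)
  have heq : finiteIdeleConorm ℚ L q =
      z * Units.map (conjFiniteAdele (↥(maximalRealSubfield L)) L (IsCMField.complexConj L) :
        FiniteAdeleRing (𝓞 L) L →* FiniteAdeleRing (𝓞 L) L) z :=
    Units.ext (by rw [coe_finiteIdeleConorm_eq_baseChange, Units.val_mul, Units.coe_map, MonoidHom.coe_coe, hq])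
  rw [heq]
  exact hprod

/-- **`T₀(𝔸_f) ∩ U_L` inside the finite idèles**: `T ∩ U_L = U_L ∩ {z | z · (c ⊗ 1) z ∈ (U_ℚ) ⊗ 1}` — a unit idèle
`z` lies in `T₀(𝔸_f)` iff its `z · (c ⊗ 1) z` is the base change of a UNIT idèle of `ℚ`
(`exists_mem_ker_of_mem_torusFinAdelic`). [cite: Liu2021, App. C Def. C.11 (p. 110)]
[cite: CasselsFrohlichANT1967, Ch. II §19] -/
theorem coe_torusFinAdelic_inter_ker_eq :
    (torusFinAdelic L : Set (FiniteAdeleRing (𝓞 L) L)ˣ) ∩ (toIdealUnits (𝓞 L) L).ker =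
      ((toIdealUnits (𝓞 L) L).ker : Set (FiniteAdeleRing (𝓞 L) L)ˣ) ∩
        (fun z : (FiniteAdeleRing (𝓞 L) L)ˣ =>
            (z : FiniteAdeleRing (𝓞 L) L) * conjFiniteAdele (↥(maximalRealSubfield L)) L (IsCMField.complexConj L) z) ⁻¹'
          ((fun q : (FiniteAdeleRing (𝓞 ℚ) ℚ)ˣ => FiniteAdeleRing.baseChange (𝓞 ℚ) ℚ L (𝓞 L) (q : FiniteAdeleRing (𝓞 ℚ) ℚ)) ''
            ((toIdealUnits (𝓞 ℚ) ℚ).ker : Set (FiniteAdeleRing (𝓞 ℚ) ℚ)ˣ)) := by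
  ext z
  simp only [Set.mem_inter_iff, SetLike.mem_coe, Set.mem_preimage, Set.mem_image]
  constructor
  · rintro ⟨hzT, hzU⟩
    obtain ⟨q, hqU, hq⟩ := exists_mem_ker_of_mem_torusFinAdelic L hzT hzU
    exact ⟨hzU, q, hqU, hq.symm⟩
  · rintro ⟨hzU, q, -, hq⟩
    exact ⟨⟨q, hq.symm⟩, hzU⟩

/-- **`T₀(𝔸_f) ∩ U_L` is compact**: by `coe_torusFinAdelic_inter_ker_eq` it is the intersection of the compact `U_L`
(`IdeleIdeal.isCompact_ker_toIdealUnits`) with the preimage, under the continuous `z ↦ z · (c ⊗ 1) z`, of the compact —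
hence closed (`𝔸_{L,f}` is Hausdorff) — image `(U_ℚ) ⊗ 1 ⊂ 𝔸_{L,f}` of `U_ℚ = Ẑ^×` under the continuous base change.
[cite: CasselsFrohlichANT1967, Ch. II §16–§17, §19] [cite: Liu2021, App. C Def. C.11 (p. 110)] -/
theorem isCompact_coe_torusFinAdelic_inter_ker :
    IsCompact ((torusFinAdelic L : Set (FiniteAdeleRing (𝓞 L) L)ˣ) ∩ (toIdealUnits (𝓞 L) L).ker) := by
  haveI : T2Space (FiniteAdeleRing (𝓞 L) L) := inferInstanceAs <| T2Space
    (Πʳ w : HeightOneSpectrum (𝓞 L), [w.adicCompletion L, w.adicCompletionIntegers L])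
  rw [coe_torusFinAdelic_inter_ker_eq]
  refine isCompact_ker_toIdealUnits.inter_right (IsClosed.preimage ?_ (IsCompact.isClosed ?_))
  · exact Units.continuous_val.mul
      ((continuous_conjFiniteAdele (↥(maximalRealSubfield L)) L (IsCMField.complexConj L)).comp Units.continuous_val)
  · exact isCompact_ker_toIdealUnits.image
      ((FiniteAdeleRing.continuous_baseChange (𝓞 ℚ) ℚ L (𝓞 L)).comp Units.continuous_val)

/-! ### §4. The unit level `Aux.unitLevel L : C5.OpenCompactSubgroup ↥(Aux.torusFinAdelic L)` -/

/-- **The unit level of the auxiliary torus**, `U := T₀(𝔸_f) ∩ ∏_v 𝒪_{L,v}^×` — the unit idèles of `L` lying in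
`T₀(𝔸_f)`, as an OPEN COMPACT subgroup of `T₀(𝔸_f)` (the tree's `C5.OpenCompactSubgroup`): the subgroup is
`(toIdealUnits (𝓞 L) L).ker.subgroupOf (torusFinAdelic L)`; it is open because `U_L` is open in the finite idèles
(`isOpen_ker_toIdealUnits`) and `T₀(𝔸_f)` carries the subspace topology, and compact because `T₀(𝔸_f) ∩ U_L` is compact
in the finite idèles (`isCompact_coe_torusFinAdelic_inter_ker`) and `T₀(𝔸_f) ↪ 𝔸_{L,f}^×` is an embedding.  A canonical
«open compact `K ⊂ T(𝔸_f)`» at which the zero-dimensional Shimura variety `T(ℚ)\T(𝔸_f)/K` of [Milne2005ShimuraVarieties]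
p. 62 is taken; the LARGEST one (`openCompactSubgroup_le_unitLevel`). [cite: Milne2005ShimuraVarieties, p. 62 L34–40]
[cite: CasselsFrohlichANT1967, Ch. II §17, §19 (U_k)] [cite: Liu2021, App. C Def. C.11 (p. 110)] -/
def unitLevel : C5.OpenCompactSubgroup ↥(torusFinAdelic L) :=
  ⟨(toIdealUnits (𝓞 L) L).ker.subgroupOf (torusFinAdelic L), by
    refine ⟨?_, ?_⟩
    · rw [Subgroup.coe_subgroupOf]
      exact (isOpen_ker_toIdealUnits L).preimage continuous_subtype_val
    · rw [Subgroup.coe_subgroupOf, Subtype.isCompact_iff]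
      convert isCompact_coe_torusFinAdelic_inter_ker L using 1
      ext z
      simp only [Set.mem_image, Set.mem_preimage, Subgroup.coe_subtype, SetLike.mem_coe, Set.mem_inter_iff]
      constructor
      · rintro ⟨y, hy, rfl⟩
        exact ⟨y.2, hy⟩
      · rintro ⟨hzT, hzU⟩
        exact ⟨⟨z, hzT⟩, hzU, rfl⟩⟩

/-- The subgroup underlying the unit level is `U_L ∩ T₀(𝔸_f)` viewed in `T₀(𝔸_f)` (definitional).
[cite: Milne2005ShimuraVarieties, p. 62 L34–40] -/
@[simp] theorem unitLevel_val : (unitLevel L).1 = (toIdealUnits (𝓞 L) L).ker.subgroupOf (torusFinAdelic L) := rfl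

/-- Membership in the unit level: `z ∈ U ⟺ z` is a unit idèle of `L` (definitional).
[cite: CasselsFrohlichANT1967, Ch. II §19 (U_k)] -/
theorem mem_unitLevel_iff (z : ↥(torusFinAdelic L)) :
    z ∈ (unitLevel L).1 ↔ (z : (FiniteAdeleRing (𝓞 L) L)ˣ) ∈ (toIdealUnits (𝓞 L) L).ker := Iff.rfl

/-- Membership in the unit level, in orders: `z ∈ U ⟺ ord_v z = 0` for every finite place `v` of `L`.
[cite: CasselsFrohlichANT1967, Ch. II §17, §19 («ideles α which have |α_v|_v = 1 for every non-archimedean v»)] -/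
theorem mem_unitLevel_iff_unitOrd (z : ↥(torusFinAdelic L)) :
    z ∈ (unitLevel L).1 ↔ ∀ v : HeightOneSpectrum (𝓞 L), unitOrd (𝓞 L) L (z : (FiniteAdeleRing (𝓞 L) L)ˣ) v = 0 :=
  mem_ker_toIdealUnits_iff _

/-- **Every compact subgroup of `T₀(𝔸_f)` lies in the unit level** (`U_L` is the unique maximal compact subgroup of the
finite idèles, `IdeleIdeal.le_ker_toIdealUnits_of_isCompact`, applied to the image of the subgroup in `𝔸_{L,f}^×`).
[cite: CasselsFrohlichANT1967, Ch. II §17 («a compact discrete group is finite»), §19] [cite: Bump1997, §3.3] -/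
theorem le_unitLevel_of_isCompact {L₀ : Subgroup ↥(torusFinAdelic L)} (h : IsCompact (L₀ : Set ↥(torusFinAdelic L))) :
    L₀ ≤ (unitLevel L).1 := by
  rw [unitLevel_val, Subgroup.subgroupOf, ← Subgroup.map_le_iff_le_comap]
  refine le_ker_toIdealUnits_of_isCompact ?_
  rw [Subgroup.coe_map]
  exact h.image continuous_subtype_val

/-- Every open compact level `L₀ ≤ T₀(𝔸_f)` is contained in the unit level: `U` is the LARGEST open compact subgroup
of `T₀(𝔸_f)`. [cite: Milne2005ShimuraVarieties, p. 62 L34–40] [cite: CasselsFrohlichANT1967, Ch. II §17, §19] -/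
theorem openCompactSubgroup_le_unitLevel (L₀ : C5.OpenCompactSubgroup ↥(torusFinAdelic L)) : L₀ ≤ unitLevel L :=
  le_unitLevel_of_isCompact L L₀.2.2

/-- **An open compact level has finite index in the unit level**: for `L₀ : C5.OpenCompactSubgroup ↥T₀(𝔸_f)` the
subgroup `L₀ ∩ U = L₀` of `U` (`L₀.1.subgroupOf (unitLevel L).1`) has finite index — `U` is compact and `L₀` is open, so
`U/L₀` is compact and discrete, hence finite («a compact discrete group is finite»).  The level-change input for the
finiteness of `T₀(ℚ)\T₀(𝔸_f)/L₀` at every level from the one at `U`. [cite: CasselsFrohlichANT1967, Ch. II §17 («a compact discrete group is finite»)]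
[cite: Milne2005ShimuraVarieties, p. 62 L34–40] -/
theorem finiteIndex_subgroupOf_unitLevel (L₀ : C5.OpenCompactSubgroup ↥(torusFinAdelic L)) :
    (L₀.1.subgroupOf (unitLevel L).1).FiniteIndex := by
  haveI : CompactSpace ↥(unitLevel L).1 := isCompact_iff_compactSpace.mp (unitLevel L).2.2
  have hopen : IsOpen ((L₀.1.subgroupOf (unitLevel L).1 : Subgroup ↥(unitLevel L).1) : Set ↥(unitLevel L).1) := by
    rw [Subgroup.coe_subgroupOf]
    exact L₀.2.1.preimage continuous_subtype_val
  haveI : DiscreteTopology (↥(unitLevel L).1 ⧸ L₀.1.subgroupOf (unitLevel L).1) :=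
    QuotientGroup.discreteTopology hopen
  haveI : CompactSpace (↥(unitLevel L).1 ⧸ L₀.1.subgroupOf (unitLevel L).1) := Quotient.compactSpace
  haveI : Finite (↥(unitLevel L).1 ⧸ L₀.1.subgroupOf (unitLevel L).1) := finite_of_compact_of_discrete
  exact Subgroup.finiteIndex_of_finite_quotient

/-- **Level change for the class groups**: for levels `L₀ ≤ L₁` of `T₀(𝔸_f)` the natural map
`T₀(ℚ)\T₀(𝔸_f)/L₀ → T₀(ℚ)\T₀(𝔸_f)/L₁` (Mathlib `QuotientGroup.map` of the identity) is onto.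
[cite: Milne2005ShimuraVarieties, p. 62 L34–40] -/
theorem classGroup_map_surjective_of_le {L₀ L₁ : C5.OpenCompactSubgroup ↥(torusFinAdelic L)} (h : L₀ ≤ L₁) :
    Function.Surjective (QuotientGroup.map ((toTorusFinAdelic L).range ⊔ L₀.1) ((toTorusFinAdelic L).range ⊔ L₁.1)
      (MonoidHom.id ↥(torusFinAdelic L)) (sup_le_sup_left h _)) := fun x => by
  induction x using QuotientGroup.induction_on with
  | H z => exact ⟨QuotientGroup.mk z, rfl⟩

/-- **Level change for finiteness** (step (5) of the route card, in full): if the class group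
`T₀(ℚ)\T₀(𝔸_f)/U` at the UNIT level is finite, then so is `T₀(ℚ)\T₀(𝔸_f)/L₀ = Aux.classGroup L L₀` at EVERY open
compact level `L₀` — in the commutative group `T = T₀(𝔸_f)` with `R = T₀(ℚ)`: `L₀ ≤ U`
(`openCompactSubgroup_le_unitLevel`), `[T : R·L₀] = [R·U : R·L₀] · [T : R·U]` (Mathlib `Subgroup.relIndex_mul_index`),
`[R·U : R·L₀] = [U : U ∩ R·L₀]` (`R·U = (R·L₀)·U`, `Subgroup.relIndex_sup_left`) divides `[U : L₀]`
(`Subgroup.relIndex_dvd_of_le_left`), which is finite (`finiteIndex_subgroupOf_unitLevel`).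
[cite: Milne2005ShimuraVarieties, p. 62 L34–40 («T(ℚ)\T(𝔸_f)/K (finite discrete set)»)]
[cite: CasselsFrohlichANT1967, Ch. II §17 («a compact discrete group is finite»)] -/
theorem finite_classGroup_of_finite_classGroup_unitLevel (h : Finite (classGroup L (unitLevel L)))
    (L₀ : C5.OpenCompactSubgroup ↥(torusFinAdelic L)) : Finite (classGroup L L₀) := by
  haveI := h
  haveI hfi : ((toTorusFinAdelic L).range ⊔ (unitLevel L).1).FiniteIndex := Subgroup.finiteIndex_of_finite_quotient
  have hL₀ : L₀.1 ≤ (unitLevel L).1 := openCompactSubgroup_le_unitLevel L L₀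
  have hle : (toTorusFinAdelic L).range ⊔ L₀.1 ≤ (toTorusFinAdelic L).range ⊔ (unitLevel L).1 :=
    sup_le_sup_left hL₀ _
  have h1 : ((toTorusFinAdelic L).range ⊔ L₀.1).relIndex ((toTorusFinAdelic L).range ⊔ (unitLevel L).1) =
      ((toTorusFinAdelic L).range ⊔ L₀.1).relIndex (unitLevel L).1 := by
    have hsup : (toTorusFinAdelic L).range ⊔ (unitLevel L).1 =
        ((toTorusFinAdelic L).range ⊔ L₀.1) ⊔ (unitLevel L).1 := by
      rw [sup_assoc, sup_eq_right.mpr hL₀]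
    rw [hsup, Subgroup.relIndex_sup_left]
  have h2 : ((toTorusFinAdelic L).range ⊔ L₀.1).relIndex (unitLevel L).1 ∣ L₀.1.relIndex (unitLevel L).1 :=
    Subgroup.relIndex_dvd_of_le_left _ le_sup_right
  have h3 : L₀.1.relIndex (unitLevel L).1 ≠ 0 := (finiteIndex_subgroupOf_unitLevel L L₀).index_ne_zero
  have h4 : ((toTorusFinAdelic L).range ⊔ L₀.1).relIndex ((toTorusFinAdelic L).range ⊔ (unitLevel L).1) ≠ 0 := by
    rw [h1]
    exact fun h0 => h3 (Nat.eq_zero_of_zero_dvd (h0 ▸ h2))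
  have h5 : ((toTorusFinAdelic L).range ⊔ L₀.1).index ≠ 0 := by
    rw [← Subgroup.relIndex_mul_index hle]
    exact mul_ne_zero h4 hfi.index_ne_zero
  haveI : ((toTorusFinAdelic L).range ⊔ L₀.1).FiniteIndex := ⟨h5⟩
  exact Subgroup.finite_quotient_of_finiteIndex

end Torus

end Aux

end UnitaryCanonicalModel

end Literature.AlgebraicGeometry.ShimuraVarieties

end
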